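import Summits.RiemannHypothesis.RiemannHypothesis.Theorems.Splittings.ScrewNullCombExpansion
import Literature.NumberTheory.LFunctions.ZetaTrivialStripBound
import Literature.NumberTheory.LFunctions.ZetaArgBacklundExplicit
import Literature.NumberTheory.LFunctions.SegmentWeights

/-!
# Splittings — SCREW NULL COMBINATIONS VII: the Dirichlet series `Σ_ρ a(ρ) ζ(s − (ρ−½))` (majorant, identity, continuation, pole)

Cell rh-split (brief sha16 f79c5f09d8bcb036), seat rh-split-typer-2 g3 (prover; own initiative «NNC WITHOUT FOZ» on the cross/screw
column, lead GO HOME/INBOX.md 03:41:07Z, checkpoints 03:51Z/03:58Z/04:09Z/04:2xZ): the series SCREW NULL COMBINATIONS I–VI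
(`ScrewNullCombUniqueness` … `ScrewNullCombination`) proved NNC = «no non-zero finite real combination
`t ↦ Σ_{j<n} z_j G_g(t, log(j+2))` of sections of Suzuki's screw kernel vanishes at every node `log(i+2)`» GIVEN finitely many
off-line zeros (`nnc_of_finite_offline`).  Parts VII–IX remove that hypothesis: NNC holds outright (`ScrewNullCombUnconditional.nnc`).
This file is part VII: the analytic inputs of the Dirichlet-series route.  For coefficients `a : {non-trivial zeros} → ℂ`
the NODE EQUATIONS `Σ_ρ a(ρ) m^{ρ−½} = A₀` (`m ≥ 1`) sum, against `m^{−s}`, to the identity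
`Σ_ρ a(ρ) ζ(s − (ρ−½)) = A₀ ζ(s)` on `Re s > 3/2` (`hasSum_dirichlet`, D1).  The convergence statement that carries the
continuation (referee g3's condition): with the weight `Σ_ρ ‖a ρ‖(2+|Im ρ|)^{3/4} < ∞` and the tree bound
`‖ζ(z)‖ ≤ 84|Im z|^{3/4}` for `Re z ≥ 0`, `|Im z| ≥ 3` (`norm_zeta_le_rpow_three_quarters`: Titchmarsh (3.5.3) on `½ ≤ σ ≤ 1`,
Thm 3.5 near `σ = 1`, and the functional equation (4.12.3) on `0 ≤ σ ≤ ½`, all landed under `Literature`), the sum over the zeros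
at ordinate distance `≥ 4` from `γ₀` converges NORMALLY on every box `{σ₁ < Re s < 4, |Im s − γ₀| < η}` with `σ₁ ≥ ½`, `η ≤ 1`
(`differentiableOn_far`, D2; the ordinate spacing enters only through the finitely many near zeros, `near_finite`); and the pole
lemma `eq_zero_of_bounded_mul_zeta` (D4: `‖c ζ(1+x)‖` bounded as `x → 0⁺` forces `c = 0`, from `riemannZeta_residue_one`).
The assembly (identity theorem on the convex box + blow-up at the rightmost pole on an ordinate) is part VIII.  [folklore]
plumbing around cited tree inputs.

HONEST LABEL: RH-free and FOZ-free analysis of Suzuki's screw kernel at the integer nodes (inputs: the tree's ζ-growth bounds,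
`riemannZeta_residue_one`, Suzuki's series (1.9) as landed in part III, Landau–Gonek and Riemann–von Mangoldt as landed in part V);
it concerns the CONDITIONAL bridge bookkeeping of cell rh-split («SPLITTING SEARCH over kernel-typed RH-EQUIVALENCES; a splitting
A ∧ B ⟹ RH is CONDITIONAL bookkeeping unless A and B are both proved») and nothing here bears on the truth of RH.
-/

set_option linter.dupNamespace false

noncomputable section

namespace Summit.RiemannHypothesis.RiemannHypothesis.Theorems.Splittings.ScrewNullComb

open Filter Topology Complex Finset Set
open Literature.NumberTheory.LFunctions

/-! ## ζ growth on `Re z ≥ 0`, `|Im z| ≥ 3` (tree bounds) -/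

/-- **Sublinear growth of `ζ` on the closed right half of the critical strip and beyond**: for `Re z ≥ 0` and
`|Im z| ≥ 3`, `‖ζ(z)‖ ≤ 84 |Im z|^{3/4}` (tree: `8|t|^{1−σ} log|t|` on `½ ≤ σ ≤ 1`, `21 log|t|` on
`σ ≥ 1 − 1/(2 log|t|)`, and the functional equation `|ζ(σ+it)| ≤ e^{1/2}(|t|/2π)^{1/2−σ}|ζ(1−σ+it)|` on `0 ≤ σ ≤ ½`).
[cite: Titchmarsh1986, §3.5 (3.5.3), Thm. 3.5, §4.12 (4.12.3)] -/
theorem norm_zeta_le_rpow_three_quarters {z : ℂ} (hre : 0 ≤ z.re) (him : 3 ≤ |z.im|) :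
    ‖riemannZeta z‖ ≤ 84 * |z.im| ^ (3 / 4 : ℝ) := by
  have ht0 : 0 < |z.im| := by linarith
  have hlog1 : 1 < Real.log |z.im| :=
    lt_of_lt_of_le (by
      have := Real.exp_one_lt_d9
      rw [← Real.exp_lt_exp, Real.exp_log (by norm_num : (0:ℝ) < 3)]
      linarith) (Real.log_le_log (by norm_num) him)
  have hlog0 : 0 < Real.log |z.im| := by linarith
  have hsqrt1 : 1 ≤ |z.im| ^ (1 / 2 : ℝ) := Real.one_le_rpow (by linarith) (by norm_num)
  -- all three regimes give `≤ 21 |t|^{1/2} log|t|`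
  have hmain : ‖riemannZeta z‖ ≤ 21 * |z.im| ^ (1 / 2 : ℝ) * Real.log |z.im| := by
    rcases lt_or_ge z.re (1 / 2) with h0 | hhalf
    · -- left of the critical line: the functional equation with the sharp factor
      have hfe := ZetaArgBacklund.norm_riemannZeta_le_fe (σ := z.re) (t := z.im) (by linarith) h0.le (by linarith)
      rw [Complex.re_add_im z] at hfe
      have hre' : (1 - (z.re : ℂ) + (z.im : ℂ) * I).re = 1 - z.re := by simp
      have him' : (1 - (z.re : ℂ) + (z.im : ℂ) * I).im = z.im := by simp
      have h1 := ZetaOneLine.norm_riemannZeta_le_rpow_mul_log (s := 1 - (z.re : ℂ) + (z.im : ℂ) * I)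
        (by rw [him']; exact him) (by rw [hre']; linarith) (by rw [hre']; linarith)
      rw [hre', him', show (1 : ℝ) - (1 - z.re) = z.re by ring] at h1
      have hexp2 : Real.exp (1 / 2) ≤ 2 := by
        have h := Real.exp_one_lt_d9
        have e : Real.exp (1 / 2) * Real.exp (1 / 2) = Real.exp 1 := by rw [← Real.exp_add]; norm_num
        nlinarith [Real.exp_pos (1 / 2 : ℝ)]
      have hfac : (|z.im| / (2 * Real.pi)) ^ (1 / 2 - z.re) ≤ |z.im| ^ (1 / 2 - z.re) :=
        Real.rpow_le_rpow (by positivity) (div_le_self ht0.le (by linarith [Real.pi_gt_three])) (by linarith)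
      have hA1 : Real.exp (1 / 2) * (|z.im| / (2 * Real.pi)) ^ (1 / 2 - z.re) ≤ 2 * |z.im| ^ (1 / 2 - z.re) :=
        mul_le_mul hexp2 hfac (by positivity) (by norm_num)
      calc ‖riemannZeta z‖ ≤ Real.exp (1 / 2) * (|z.im| / (2 * Real.pi)) ^ (1 / 2 - z.re) *
            ‖riemannZeta (1 - (z.re : ℂ) + (z.im : ℂ) * I)‖ := hfe
        _ ≤ 2 * |z.im| ^ (1 / 2 - z.re) * (8 * |z.im| ^ z.re * Real.log |z.im|) :=
            mul_le_mul hA1 h1 (norm_nonneg _) (by positivity)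
        _ = 16 * (|z.im| ^ (1 / 2 - z.re) * |z.im| ^ z.re) * Real.log |z.im| := by ring
        _ = 16 * |z.im| ^ (1 / 2 : ℝ) * Real.log |z.im| := by rw [← Real.rpow_add ht0]; norm_num
        _ ≤ 21 * |z.im| ^ (1 / 2 : ℝ) * Real.log |z.im| := by gcongr; norm_num
    rcases le_or_gt z.re 1 with h1 | h1
    · have h := ZetaOneLine.norm_riemannZeta_le_rpow_mul_log him hhalf h1
      have hexp : |z.im| ^ (1 - z.re) ≤ |z.im| ^ (1 / 2 : ℝ) :=
        Real.rpow_le_rpow_of_exponent_le (by linarith) (by linarith)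
      calc ‖riemannZeta z‖ ≤ 8 * |z.im| ^ (1 - z.re) * Real.log |z.im| := h
        _ ≤ 8 * |z.im| ^ (1 / 2 : ℝ) * Real.log |z.im| := by gcongr
        _ ≤ 21 * |z.im| ^ (1 / 2 : ℝ) * Real.log |z.im| := by gcongr; norm_num
    · have hσ : 1 - 1 / (2 * Real.log |z.im|) ≤ z.re := by
        have : 0 < 1 / (2 * Real.log |z.im|) := by positivity
        linarith
      have h := ZetaOneLine.norm_riemannZeta_le_log him hσ
      calc ‖riemannZeta z‖ ≤ 21 * Real.log |z.im| := h
        _ = 21 * 1 * Real.log |z.im| := by ring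
        _ ≤ 21 * |z.im| ^ (1 / 2 : ℝ) * Real.log |z.im| := by gcongr
  have hlog := SegmentWeights.log_le_four_mul_rpow_quarter ht0.le
  calc ‖riemannZeta z‖ ≤ 21 * |z.im| ^ (1 / 2 : ℝ) * Real.log |z.im| := hmain
    _ ≤ 21 * |z.im| ^ (1 / 2 : ℝ) * (4 * |z.im| ^ (1 / 4 : ℝ)) := by gcongr
    _ = 84 * (|z.im| ^ (1 / 2 : ℝ) * |z.im| ^ (1 / 4 : ℝ)) := by ring
    _ = 84 * |z.im| ^ (3 / 4 : ℝ) := by rw [← Real.rpow_add ht0]; norm_num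

/-! ## D1. The Dirichlet-series identity `Σ_ρ a(ρ) ζ(s − (ρ−½)) = A₀ ζ(s)` on `Re s > 3/2` -/

/-- `ζ(z) = Σ_{n ≥ 0} (n+1)^{-z}` as a `HasSum`, `Re z > 1`. [folklore] -/
theorem hasSum_zeta_cpow_neg {z : ℂ} (hz : 1 < z.re) :
    HasSum (fun n : ℕ ↦ ((n + 1 : ℕ) : ℂ) ^ (-z)) (riemannZeta z) := by
  have hsum : Summable (fun n : ℕ ↦ 1 / ((n : ℂ) + 1) ^ z) := by
    have h := (Complex.summable_one_div_nat_cpow (p := z)).2 hz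
    have h' := (summable_nat_add_iff 1).2 h
    refine h'.congr fun n ↦ ?_
    push_cast; ring_nf
  have heq := zeta_eq_tsum_one_div_nat_add_one_cpow hz
  rw [heq]
  refine (hsum.hasSum).congr_fun fun n ↦ ?_
  rw [Complex.cpow_neg, one_div]
  push_cast; ring_nf

/-- The real part of a non-trivial zero is `< 1`, so `Re(s − (ρ−½)) > 1` for `Re s > 3/2`. [folklore] -/
theorem one_lt_re_sub (ρ : ZetaZeros.riemannZetaNontrivialZeros) {s : ℂ} (hs : 3 / 2 < s.re) :
    1 < (s - ((ρ : ℂ) - 1 / 2)).re := by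
  have h1 := ZetaZeros.riemannZetaNontrivialZeros.re_lt_one ρ.2
  simp only [sub_re, one_div]
  norm_num
  linarith

/-- Summability of the double family `(ρ, n) ↦ a(ρ)(n+1)^{ρ−½}(n+1)^{−s}` for `Re s > 3/2`. [folklore] -/
theorem summable_double (a : ZetaZeros.riemannZetaNontrivialZeros → ℂ) (ha : Summable fun ρ ↦ ‖a ρ‖)
    {s : ℂ} (hs : 3 / 2 < s.re) :
    Summable fun p : ZetaZeros.riemannZetaNontrivialZeros × ℕ ↦
      a p.1 * ((p.2 + 1 : ℕ) : ℂ) ^ ((p.1 : ℂ) - 1 / 2) * ((p.2 + 1 : ℕ) : ℂ) ^ (-s) := by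
  have hg : Summable fun n : ℕ ↦ ‖(((n + 1 : ℕ) : ℝ) ^ (1 / 2 - s.re) : ℝ)‖ := by
    have h : Summable fun n : ℕ ↦ ((n : ℝ) ^ (1 / 2 - s.re)) :=
      (Real.summable_nat_rpow).2 (by linarith)
    have h' : Summable fun n : ℕ ↦ (((n + 1 : ℕ) : ℝ) ^ (1 / 2 - s.re)) := by
      have := (summable_nat_add_iff 1).2 h
      exact this.congr fun n ↦ by push_cast; rfl
    exact h'.norm
  refine Summable.of_norm_bounded (summable_mul_of_summable_norm ha.norm hg) fun p ↦ ?_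
  rcases p with ⟨ρ, n⟩
  have hn0 : (0 : ℝ) < ((n + 1 : ℕ) : ℝ) := by exact_mod_cast Nat.succ_pos n
  have hn1 : (1 : ℝ) ≤ ((n + 1 : ℕ) : ℝ) := by exact_mod_cast Nat.succ_le_succ (Nat.zero_le n)
  have hre : ((ρ : ℂ) - 1 / 2).re + -s.re ≤ 1 / 2 - s.re := by
    have := ZetaZeros.riemannZetaNontrivialZeros.re_lt_one ρ.2
    have e : ((ρ : ℂ) - 1 / 2).re = (ρ : ℂ).re - 1 / 2 := by simp
    rw [e]; linarith
  dsimp only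
  rw [norm_mul, norm_mul, Complex.norm_natCast_cpow_of_pos (Nat.succ_pos n),
    Complex.norm_natCast_cpow_of_pos (Nat.succ_pos n), neg_re, mul_assoc, ← Real.rpow_add hn0]
  exact mul_le_mul_of_nonneg_left (Real.rpow_le_rpow_of_exponent_le hn1 hre) (norm_nonneg _)

/-- **D1.** From the node equations `Σ_ρ a(ρ) m^{ρ−½} = A₀` (`m ≥ 1`) and `Σ ‖a‖ < ∞`:
`Σ_ρ a(ρ) ζ(s − (ρ − ½)) = A₀ ζ(s)` for `Re s > 3/2` (absolutely convergent double series, Fubini). [folklore] -/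
theorem hasSum_dirichlet (a : ZetaZeros.riemannZetaNontrivialZeros → ℂ) (A₀ : ℂ)
    (ha : Summable fun ρ ↦ ‖a ρ‖)
    (hnode : ∀ n : ℕ, HasSum (fun ρ ↦ a ρ * ((n + 1 : ℕ) : ℂ) ^ ((ρ : ℂ) - 1 / 2)) A₀)
    {s : ℂ} (hs : 3 / 2 < s.re) :
    HasSum (fun ρ : ZetaZeros.riemannZetaNontrivialZeros ↦ a ρ * riemannZeta (s - ((ρ : ℂ) - 1 / 2)))
      (A₀ * riemannZeta s) := by
  have hS := (summable_double a ha hs).hasSum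
  -- fibres over `ρ`
  have hfib1 : ∀ ρ : ZetaZeros.riemannZetaNontrivialZeros,
      HasSum (fun n : ℕ ↦ a ρ * ((n + 1 : ℕ) : ℂ) ^ ((ρ : ℂ) - 1 / 2) * ((n + 1 : ℕ) : ℂ) ^ (-s))
        (a ρ * riemannZeta (s - ((ρ : ℂ) - 1 / 2))) := by
    intro ρ
    have h := (hasSum_zeta_cpow_neg (one_lt_re_sub ρ hs)).mul_left (a ρ)
    refine h.congr_fun fun n ↦ ?_
    have hn : ((n + 1 : ℕ) : ℂ) ≠ 0 := by exact_mod_cast Nat.succ_ne_zero n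
    have e : ((n + 1 : ℕ) : ℂ) ^ (-(s - ((ρ : ℂ) - 1 / 2))) =
        ((n + 1 : ℕ) : ℂ) ^ ((ρ : ℂ) - 1 / 2) * ((n + 1 : ℕ) : ℂ) ^ (-s) := by
      rw [← Complex.cpow_add _ _ hn]; congr 1; ring
    rw [e, mul_assoc]
  have h1 := hS.prod_fiberwise hfib1
  -- fibres over `n`
  have hS' := (Equiv.hasSum_iff (Equiv.prodComm ℕ ZetaZeros.riemannZetaNontrivialZeros)).2 hS
  have hfib2 : ∀ n : ℕ, HasSum (fun ρ : ZetaZeros.riemannZetaNontrivialZeros ↦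
      ((fun p : ZetaZeros.riemannZetaNontrivialZeros × ℕ ↦
        a p.1 * ((p.2 + 1 : ℕ) : ℂ) ^ ((p.1 : ℂ) - 1 / 2) * ((p.2 + 1 : ℕ) : ℂ) ^ (-s)) ∘
          (Equiv.prodComm ℕ ZetaZeros.riemannZetaNontrivialZeros)) (n, ρ))
      (A₀ * ((n + 1 : ℕ) : ℂ) ^ (-s)) := fun n ↦ by
    simpa using (hnode n).mul_right (((n + 1 : ℕ) : ℂ) ^ (-s))
  have h2 := hS'.prod_fiberwise hfib2
  have h3 : HasSum (fun n : ℕ ↦ A₀ * ((n + 1 : ℕ) : ℂ) ^ (-s)) (A₀ * riemannZeta s) :=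
    (hasSum_zeta_cpow_neg (by linarith)).mul_left A₀
  rw [h2.unique h3] at h1
  exact h1

/-! ## D4 input: `c·ζ(1+x)` bounded as `x → 0⁺` forces `c = 0` -/

/-- The pole of `ζ` at `1`: if `‖c ζ(1+x)‖ ≤ M` for all small `x > 0` then `c = 0`. [folklore] -/
theorem eq_zero_of_bounded_mul_zeta {c : ℂ} {M δ₀ : ℝ} (hδ₀ : 0 < δ₀)
    (h : ∀ x : ℝ, 0 < x → x < δ₀ → ‖c * riemannZeta (1 + x)‖ ≤ M) : c = 0 := by
  by_contra hc
  have hc0 : 0 < ‖c‖ := norm_pos_iff.2 hc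
  -- from the residue: eventually `‖(s-1)ζ(s) - 1‖ < 1/2` near `1`
  have hres := riemannZeta_residue_one
  have hev : ∀ᶠ s : ℂ in 𝓝[≠] 1, ‖(s - 1) * riemannZeta s - 1‖ < 1 / 2 := by
    have := (Metric.tendsto_nhds.1 hres) (1 / 2) (by norm_num)
    simpa [dist_eq_norm] using this
  rw [eventually_nhdsWithin_iff, Metric.eventually_nhds_iff] at hev
  obtain ⟨ε, hε, hball⟩ := hev
  -- `M ≥ 0`
  have hM0 : 0 ≤ M := by
    have hx : (0 : ℝ) < min (δ₀ / 2) 1 := lt_min (by linarith) one_pos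
    exact (norm_nonneg _).trans (h _ hx (lt_of_le_of_lt (min_le_left _ _) (by linarith)))
  -- choose a small `x`
  set x : ℝ := min (min (δ₀ / 2) (ε / 2)) (‖c‖ / (4 * (M + 1))) with hx
  have hxpos : 0 < x := by
    rw [hx]; refine lt_min (lt_min (by linarith) (by linarith)) (by positivity)
  have hxδ : x < δ₀ := lt_of_le_of_lt ((min_le_left _ _).trans (min_le_left _ _)) (by linarith)
  have hxε : x < ε := lt_of_le_of_lt ((min_le_left _ _).trans (min_le_right _ _)) (by linarith)
  have hxc : x ≤ ‖c‖ / (4 * (M + 1)) := min_le_right _ _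
  -- the residue estimate at `s = 1 + x`
  have hs1 : ((1 : ℂ) + x) ≠ 1 := by
    intro h'
    have : (x : ℂ) = 0 := by linear_combination h'
    exact hxpos.ne' (by exact_mod_cast this)
  have hdist : dist ((1 : ℂ) + x) 1 < ε := by
    rw [dist_eq_norm, show (1 : ℂ) + x - 1 = x by ring, Complex.norm_real, Real.norm_eq_abs, abs_of_pos hxpos]
    exact hxε
  have hr := hball hdist hs1
  rw [show (1 : ℂ) + x - 1 = x by ring] at hr
  -- `‖x ζ(1+x)‖ ≥ 1/2`
  have hlow : 1 / 2 ≤ ‖(x : ℂ) * riemannZeta (1 + x)‖ := by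
    have h1 := norm_sub_norm_le (1 : ℂ) ((x : ℂ) * riemannZeta (1 + x))
    rw [norm_one, norm_sub_rev] at h1
    linarith
  -- combine with the bound
  have hup := h x hxpos hxδ
  have hkey : ‖c‖ / 2 ≤ M * x := by
    have e : ‖(x : ℂ) * riemannZeta (1 + x)‖ = x * ‖riemannZeta (1 + x)‖ := by
      rw [norm_mul, Complex.norm_real, Real.norm_eq_abs, abs_of_pos hxpos]
    rw [e] at hlow
    rw [norm_mul] at hup
    -- ‖c‖ ‖ζ‖ ≤ M and x‖ζ‖ ≥ 1/2
    nlinarith [norm_nonneg (riemannZeta (1 + (x : ℂ))), norm_nonneg c]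
  have : M * x ≤ M * (‖c‖ / (4 * (M + 1))) := mul_le_mul_of_nonneg_left hxc hM0
  have h2 : M * (‖c‖ / (4 * (M + 1))) < ‖c‖ / 2 := by
    rw [mul_div_assoc']
    rw [div_lt_div_iff₀ (by positivity) (by norm_num)]
    nlinarith
  linarith

/-! ## D2 input: the far terms are uniformly bounded on boxes right of `Re s = ½` -/

/-- For `s` in the box `σ₁ < Re s`, `|Im s − γ₀| < 1` with `σ₁ ≥ ½`, and a zero `ρ` at ordinate distance `≥ 4` from
`γ₀`: `‖ζ(s − (ρ−½))‖ ≤ 84 (1+|γ₀|)^{3/4} (2+|Im ρ|)^{3/4}`. [folklore] -/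
theorem norm_zeta_shift_le {γ₀ σ₁ : ℝ} (hσ₁ : 1 / 2 ≤ σ₁) {s : ℂ} (hs1 : σ₁ < s.re) (hs2 : |s.im - γ₀| < 1)
    (ρ : ZetaZeros.riemannZetaNontrivialZeros) (hfar : 4 ≤ |(ρ : ℂ).im - γ₀|) :
    ‖riemannZeta (s - ((ρ : ℂ) - 1 / 2))‖ ≤
      84 * ((1 + |γ₀|) ^ (3 / 4 : ℝ) * (2 + |(ρ : ℂ).im|) ^ (3 / 4 : ℝ)) := by
  have hβ := ZetaZeros.riemannZetaNontrivialZeros.re_lt_one ρ.2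
  have hre : 0 ≤ (s - ((ρ : ℂ) - 1 / 2)).re := by
    simp only [sub_re, one_div]; norm_num; linarith
  have him_eq : (s - ((ρ : ℂ) - 1 / 2)).im = s.im - (ρ : ℂ).im := by simp
  have him3 : 3 ≤ |(s - ((ρ : ℂ) - 1 / 2)).im| := by
    rw [him_eq]
    have h1 : |(ρ : ℂ).im - γ₀| ≤ |s.im - (ρ : ℂ).im| + |s.im - γ₀| := by
      have := abs_sub_le ((ρ : ℂ).im) s.im γ₀
      rw [abs_sub_comm ((ρ : ℂ).im) s.im] at this
      exact this
    linarith
  have himle : |(s - ((ρ : ℂ) - 1 / 2)).im| ≤ (1 + |γ₀|) * (2 + |(ρ : ℂ).im|) := by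
    rw [him_eq]
    have h1 : |s.im - (ρ : ℂ).im| ≤ |s.im - γ₀| + |γ₀| + |(ρ : ℂ).im| := by
      have := abs_sub_le s.im γ₀ ((ρ : ℂ).im)
      have := abs_sub (γ₀) ((ρ : ℂ).im)
      linarith
    nlinarith [abs_nonneg γ₀, abs_nonneg ((ρ : ℂ).im), abs_nonneg (s.im - γ₀)]
  have h := norm_zeta_le_rpow_three_quarters hre him3
  calc ‖riemannZeta (s - ((ρ : ℂ) - 1 / 2))‖ ≤ 84 * |(s - ((ρ : ℂ) - 1 / 2)).im| ^ (3 / 4 : ℝ) := h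
    _ ≤ 84 * ((1 + |γ₀|) * (2 + |(ρ : ℂ).im|)) ^ (3 / 4 : ℝ) := by
        gcongr
    _ = 84 * ((1 + |γ₀|) ^ (3 / 4 : ℝ) * (2 + |(ρ : ℂ).im|) ^ (3 / 4 : ℝ)) := by
        rw [Real.mul_rpow (by positivity) (by positivity)]

/-! ## D2–D4. Assembly: every coefficient vanishes

* `near_finite` — the zeros with `|Im ρ − γ₀| < 4` form a finite set (inside `weilZeroIndex (|γ₀|+4)`);
* `differentiableOn_far` — `s ↦ Σ_{far ρ} a(ρ) ζ(s − (ρ−½))` is differentiable on the box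
  `U = {σ₁ < Re s < 4, |Im s − γ₀| < η}` (`σ₁ ≥ ½`, `η ≤ 1`) by `Complex.differentiableOn_tsum_of_summable_norm`
  with the uniform majorant `‖a ρ‖ · 84(1+|γ₀|)^{3/4}(2+|Im ρ|)^{3/4}` (`norm_zeta_shift_le`);
* identity theorem on the convex box: `Σ_near + Σ_far = A₀ ζ` on `U` (agreement on `U ∩ {Re s > 3/2}` by
  `hasSum_dirichlet`; `η ≤ |γ₀|/2` keeps `s = 1` out of `U`);
* `coeff_eq_zero_of_nodes` (part VIII) — assuming `a ρ₀ ≠ 0`, pick `ρ*` of maximal real part among `{Im ρ = Im ρ₀, a ρ ≠ 0}`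
  (a finite set), take `σ₁ = Re ρ* + ½ > ½`, bound the remainder on the segment `s = σ₁ + x + iγ₀`, and apply
  `eq_zero_of_bounded_mul_zeta`. -/

/-- The zeros within ordinate distance `4` of `γ₀` form a finite set. [folklore] -/
theorem near_finite (γ₀ : ℝ) :
    Set.Finite {ρ : ZetaZeros.riemannZetaNontrivialZeros | |(ρ : ℂ).im - γ₀| < 4} := by
  refine ((weilZeroIndex_finite (|γ₀| + 4)).preimage Subtype.val_injective.injOn).subset fun ρ hρ ↦ ?_
  rw [Set.mem_preimage, weilZeroIndex_eq_inter]
  refine ⟨ρ.2, ?_⟩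
  simp only [Set.mem_setOf_eq] at hρ ⊢
  have := abs_sub_abs_le_abs_sub ((ρ : ℂ).im) γ₀
  linarith

/-- **D2, far part.** On the box `σ₁ < Re s < 4`, `|Im s − γ₀| < η` (`σ₁ ≥ ½`, `η ≤ 1`) the series over the zeros at
ordinate distance `≥ 4` from `γ₀` is differentiable, with the uniform majorant of `norm_zeta_shift_le`. [folklore] -/
theorem differentiableOn_far (a : ZetaZeros.riemannZetaNontrivialZeros → ℂ)
    (hA : Summable fun ρ ↦ ‖a ρ‖ * (2 + |(ρ : ℂ).im|) ^ (3 / 4 : ℝ)) {γ₀ σ₁ η : ℝ} (hσ₁ : 1 / 2 ≤ σ₁) (hη : η ≤ 1)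
    (far : Finset ZetaZeros.riemannZetaNontrivialZeros)
    (hfar : ∀ ρ, ρ ∉ far → 4 ≤ |(ρ : ℂ).im - γ₀|) :
    DifferentiableOn ℂ (fun s ↦ ∑' ρ : {ρ // ρ ∉ far}, a ρ * riemannZeta (s - ((ρ : ℂ) - 1 / 2)))
      {s : ℂ | σ₁ < s.re ∧ s.re < 4 ∧ |s.im - γ₀| < η} ∧
    ∀ s : ℂ, σ₁ < s.re → |s.im - γ₀| < η →
      ‖∑' ρ : {ρ // ρ ∉ far}, a ρ * riemannZeta (s - ((ρ : ℂ) - 1 / 2))‖ ≤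
        ∑' ρ : {ρ // ρ ∉ far}, ‖a (ρ : ZetaZeros.riemannZetaNontrivialZeros)‖ *
          (84 * ((1 + |γ₀|) ^ (3 / 4 : ℝ) * (2 + |((ρ : ZetaZeros.riemannZetaNontrivialZeros) : ℂ).im|) ^ (3 / 4 : ℝ))) := by
  set u : {ρ // ρ ∉ far} → ℝ := fun ρ ↦ ‖a (ρ : ZetaZeros.riemannZetaNontrivialZeros)‖ *
    (84 * ((1 + |γ₀|) ^ (3 / 4 : ℝ) * (2 + |((ρ : ZetaZeros.riemannZetaNontrivialZeros) : ℂ).im|) ^ (3 / 4 : ℝ))) with hu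
  have hu_sum : Summable u := by
    have h := (hA.subtype fun ρ ↦ ρ ∉ far).mul_left (84 * (1 + |γ₀|) ^ (3 / 4 : ℝ))
    refine h.congr fun ρ ↦ ?_
    simp only [hu, Function.comp_apply]; ring
  have hbound : ∀ (ρ : {ρ // ρ ∉ far}) (s : ℂ), σ₁ < s.re → |s.im - γ₀| < η →
      ‖a ρ * riemannZeta (s - ((ρ : ℂ) - 1 / 2))‖ ≤ u ρ := by
    intro ρ s hs1 hs2
    rw [hu, norm_mul]
    exact mul_le_mul_of_nonneg_left (norm_zeta_shift_le hσ₁ hs1 (lt_of_lt_of_le hs2 hη) ρ (hfar ρ ρ.2))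
      (norm_nonneg _)
  have hopen : IsOpen {s : ℂ | σ₁ < s.re ∧ s.re < 4 ∧ |s.im - γ₀| < η} := by
    have h1 : IsOpen {s : ℂ | σ₁ < s.re} := isOpen_lt continuous_const Complex.continuous_re
    have h2 : IsOpen {s : ℂ | s.re < 4} := isOpen_lt Complex.continuous_re continuous_const
    have h3 : IsOpen {s : ℂ | |s.im - γ₀| < η} :=
      isOpen_lt (continuous_abs.comp (Complex.continuous_im.sub continuous_const)) continuous_const
    have e : {s : ℂ | σ₁ < s.re ∧ s.re < 4 ∧ |s.im - γ₀| < η} =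
        {s : ℂ | σ₁ < s.re} ∩ ({s : ℂ | s.re < 4} ∩ {s : ℂ | |s.im - γ₀| < η}) := by
      ext s; simp [Set.mem_inter_iff]
    rw [e]; exact h1.inter (h2.inter h3)
  refine ⟨?_, ?_⟩
  · refine Complex.differentiableOn_tsum_of_summable_norm hu_sum (fun ρ ↦ ?_) hopen
      (fun ρ s hs ↦ hbound ρ s hs.1 hs.2.2)
    intro s hs
    have hne : s - ((ρ : ℂ) - 1 / 2) ≠ 1 := by
      intro h
      have him : s.im = ((ρ : ZetaZeros.riemannZetaNontrivialZeros) : ℂ).im := by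
        have := congrArg Complex.im h; simp at this; linarith
      have h4 := hfar ρ ρ.2
      have h2 := hs.2.2
      rw [him] at h2
      linarith
    exact (((differentiableAt_riemannZeta hne).comp s
      ((differentiableAt_id).sub_const _)).const_mul (a ρ)).differentiableWithinAt
  · intro s hs1 hs2
    have hs : Summable fun ρ : {ρ // ρ ∉ far} ↦ ‖a ρ * riemannZeta (s - ((ρ : ℂ) - 1 / 2))‖ :=
      .of_nonneg_of_le (fun _ ↦ norm_nonneg _) (fun ρ ↦ hbound ρ s hs1 hs2) hu_sum
    exact (norm_tsum_le_tsum_norm hs).trans (hs.tsum_le_tsum (fun ρ ↦ hbound ρ s hs1 hs2) hu_sum)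

/-- A single shifted term `s ↦ a ζ(s − (ρ−½))` is continuous (indeed differentiable) on any set avoiding the pole
`ρ + ½`, and identically zero if `a = 0`. [folklore] -/
theorem differentiableOn_term (c ρ : ℂ) {U : Set ℂ} (hU : c ≠ 0 → ∀ s ∈ U, s - (ρ - 1 / 2) ≠ 1) :
    DifferentiableOn ℂ (fun s ↦ c * riemannZeta (s - (ρ - 1 / 2))) U := by
  by_cases hc : c = 0
  · simp only [hc, zero_mul]; exact differentiableOn_const 0
  · intro s hs
    exact (((differentiableAt_riemannZeta (hU hc s hs)).comp s
      ((differentiableAt_id).sub_const _)).const_mul c).differentiableWithinAt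

end Summit.RiemannHypothesis.RiemannHypothesis.Theorems.Splittings.ScrewNullComb

end
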